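import Summits.RiemannHypothesis.RiemannHypothesis.Theorems.TiltedLandingLaw421R3FarStateRead

/-!
# W-09 far branch · «SinkFeedLid» — the sink feed with cut points AT the state: 102's certificate closes the sink UP TO THE LID (C4 kernel desk rh-idea-6 g44)

SUPPORT (K only; asserts no law; RH is NOT proved; ⟨33346⟩/⟨33347⟩ OPEN).  ONE import, landed: «FarStateRead» (the state read `T` of `lineRem` at the
state: S1 `exists_tendsto_lineRem_state`, S2 `norm_le_of_tendsto_state`, S3 `twoPoint_state`; through it #1268 «SinkFeedM» and its whole cone —
★★M `RhW08.FarPricingM.im_lineRem_eq_farPull_mult`, #1258's frame helpers, C3's template #1255, (E) #1254).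

CONTENT = #1268's three ★m with the cut points allowed AT THE STATE (proofs verbatim on ★★M's list; the only change is that each cut carries a
READ VALUE `G_k` — `lineRem f j v R p_k` at a non-zero cut point, the state read `T` at a state cut — with `‖G_k‖ ≤ η/s` and ★M's two-point data
at `(w, p_k)`):
★1ℓ `lcert_le_of_kernelDom_lid` — C3's `AssemblySig` FED from the tree for admissible cut families whose points are non-zeros with `0 < Im p_k ≤ hmax`
OR the state `v` (with `Im v ≤ hmax`); (K) `KernelDom v.re R cs w σ` THE hypothesis ⇒ `Lcert cs (lineRem f j v R w) σ ≤ η/s`;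
★2ℓ `le_of_certificate_lid` — + the datum alternative (D) ⇒ `gnorm ≤ lam·η/s`;
★3ℓ `norm_farFieldAt_le_of_certificatesExist_lid` — 102's `CertificatesExistSig lam` ⇒ `‖farFieldAt f j v w‖ ≤ lam·η/s` at EVERY `R/2`-isolated
state of any multiplicity with `0 < Im v ≤ hmax` — LID INCLUDED — and every nested child of drop `< s/4`: ★3m's binder `Im v < hmax` (#1268 :206)
is GONE (at the lid 102's top cut point `⟨Re v, hmax⟩` is `v`, read through `T`).  So exactly 102's `CertificatesExistSig lam` ((K∂) + (D); C3/C1 —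
or its right-sided form via #1269 `RhW08.SinkMirror.certificatesExistSig_of_right`) stands between the tree and the sink inequality of
`RhW08.FLink.FarFieldModulusLawBoxPl lam` at band children, on the whole box `0 < Im v ≤ hmax`.
No def, no twin of an importable statement (★1m/★2m/★3m of #1268 are the cited special cases: every cut point a non-zero, `Im v < hmax`).
-/

noncomputable section

namespace RhW08.SinkFeedLid

open Complex Filter Topology Set
open scoped ComplexConjugate
open RhW08.Round1 RhW08.StSwap RhW08.Round2 RhW08.QuadW
open RhW08.SealSwap (PBot)
open RhW08.SealSwapQ RhW08.RateSplit RhW08.IsolatedTilt RhW08.FarStep RhW08.BurgersRate RhW08.PurseP RhW08.BurgersRateG3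
open RhIdea6.G17.W07C7 RhIdea6.G17.W07C7.Rev6 RhIdea6.G18.W07C8.Law421BirthS RhIdea6.G19.W07C11.Seam
open RhIdea6.G20.W07C12.Frac RhIdea6.G20.W07C12.StColP RhW07.C12.FieldSplit RhIdea6.G21.W07C13.TentMax
open RhW07.C14.TwoSided RhW07.C14.Classes RhW07.C14.Lineage RhW07.C14.Booking
open RhW08.FLink RhW08.FLinkGain RhW08.FLinkGainSeam
open RhW08.GainTwoPoint RhW08.FarPricing RhW08.SinkTemplate RhW08.SinkFeed RhW08.FarTwoPointM RhW08.FarPricingM RhW08.SinkFeedM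
open RhW08.FarStateRead

/-! ## §L1 THE FEED with cut points allowed AT the state -/

/-- ★ℓ (K) **TREE-SIDE SINK ASSEMBLY at ANY multiplicity, cut points AT THE STATE ALLOWED**: as #1268's ★1m
`RhW08.SinkFeedM.lcert_le_of_kernelDom_mult`, but each cut point is EITHER a non-zero of `f⁽ʲ⁾` on the axis with `0 < Im p_k ≤ hmax` OR the state `v`
itself with `Im v ≤ hmax` — the seam read of a state cut is the state read `T = lim_{z → v, z ≠ v} lineRem f j v R z` («FarStateRead» S1–S3:
`‖T‖ ≤ η/s`, and ★M's two-point data at `(w, v)` with value `lineRem w − T`).  (K) `KernelDom v.re R cs w σ` THE hypothesis ⇒ `L_cert ≤ η/s`. -/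
theorem lcert_le_of_kernelDom_lid {η : ℝ} {f : ℂ → ℂ} {x₀ s hmax R Hs : ℝ} {B : ℕ} (hE : EngineHyps5 2 η f x₀ s hmax R Hs B) {j : ℕ}
    {v w : ℂ} (hRB : LevelRemainderBox η f x₀ s hmax R j) (hcol : |v.re - x₀| ≤ R / 2) (hFv : iteratedDeriv j f v = 0)
    (hv0 : 0 < v.im)
    (hiso : ∀ z : ℂ, iteratedDeriv j f z = 0 → |z.re - v.re| < R / 2 → z = v ∨ z = conj v)
    (hw : iteratedDeriv j f w ≠ 0) (hwim : 0 < w.im) (hwre : |w.re - v.re| ≤ R / 3)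
    {κ : Type} [Fintype κ] {cs : κ → Cut} (hadm : CutsAdmissible v.re cs)
    (hpts : ∀ k, (iteratedDeriv j f (cs k).p ≠ 0 ∧ 0 < (cs k).p.im ∧ (cs k).p.im ≤ hmax) ∨ ((cs k).p = v ∧ v.im ≤ hmax))
    {σ : ℝ} (hK : KernelDom v.re R cs w σ) :
    Lcert cs (lineRem f j v R w) σ ≤ η / s := by
  obtain ⟨ι, a, hfar, -, -, hexp, htwo, hpull⟩ := im_lineRem_eq_farPull_mult hE hFv hv0 hiso
  have hR : 0 < R := RhW08.ClusterQ.R_pos_of_engine hE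
  have hHs0 : 0 ≤ Hs := hE.2.2.2.2.2.2.2.1
  have hHsR : 2 * Hs ≤ R := hE.2.2.2.2.2.2.2.2.2.1
  -- the reflection-symmetric multiplicity of the export
  set n : ℂ → ℝ := fun c ↦ (if c = v ∨ c = conj v then (0 : ℝ) else (analyticOrderNatAt (iteratedDeriv j f) c : ℝ)) with hndef
  have hn : ∀ c, n (conj c) = n c := by
    intro c
    have h1 : (conj c = v ∨ conj c = conj v) ↔ (c = v ∨ c = conj v) := by
      constructor
      · rintro (h | h)
        · exact Or.inr (by rw [← h, conj_conj])
        · exact Or.inl (by simpa using congrArg conj h)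
      · rintro (h | h)
        · exact Or.inr (by rw [h])
        · exact Or.inl (by rw [h, conj_conj])
    simp only [hndef, h1, analyticOrderNatAt, analyticOrderAt_conj_eq hE]
  -- the list: far, in the strip, reflected entries are zeros too; non-zeros and the state avoid the list and its reflection
  have hnz : iteratedDeriv j f ≠ 0 := fun h ↦ hw (by rw [h]; rfl)
  have hfar' : ∀ i, R / 2 ≤ |(a i).re - v.re| := fun i ↦ (hfar i).2
  have hstripa : ∀ i, |(a i).im| ≤ Hs := fun i ↦ RhW08.Column.abs_im_le_of_level hE hnz (hfar i).1
  have hconj0 : ∀ i, iteratedDeriv j f (conj (a i)) = 0 := fun i ↦ by rw [iteratedDeriv_conj hE, (hfar i).1, map_zero]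
  have hav : ∀ {z : ℂ}, iteratedDeriv j f z ≠ 0 → ∀ i, z ≠ a i := fun hz i h ↦ hz (by rw [h]; exact (hfar i).1)
  have havc : ∀ {z : ℂ}, iteratedDeriv j f z ≠ 0 → ∀ i, z ≠ conj (a i) := fun hz i h ↦ hz (by rw [h]; exact hconj0 i)
  have hva : ∀ i, v ≠ a i := fun i h ↦ by
    have h' := hfar' i
    rw [← h, sub_self, abs_zero] at h'
    linarith
  have hvac : ∀ i, v ≠ conj (a i) := fun i h ↦ by
    have h' := hfar' i
    rw [← conj_re (a i), ← h, sub_self, abs_zero] at h'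
    linarith
  -- the cut points: on the axis, in the slab
  have hpre : ∀ k, (cs k).p.re = v.re := fun k ↦ (hadm.1 k).2.2
  have hpslab : ∀ k, |(cs k).p.re - v.re| ≤ R / 3 := fun k ↦ by
    rw [hpre k, sub_self, abs_zero]; positivity
  -- PER CUT: a read value `G k` with the seam bound and ★M's two-point data at `(w, p_k)` — `lineRem p_k` off the state, the state read `T` at it
  have hdata : ∀ k, ∃ G : ℂ, ‖G‖ ≤ η / s ∧ Summable (fun i ↦ 1 / (‖w - a i‖ * ‖(cs k).p - a i‖)) ∧
      Summable (fun i ↦ (1 / (w - a i) - 1 / ((cs k).p - a i))) ∧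
      lineRem f j v R w - G = ∑' i, (1 / (w - a i) - 1 / ((cs k).p - a i)) ∧ (∀ i, (cs k).p ≠ a i) ∧ ∀ i, (cs k).p ≠ conj (a i) := by
    intro k
    rcases hpts k with ⟨hp0, hpim⟩ | ⟨hpv, hvh⟩
    · obtain ⟨h1, h2, h3⟩ := htwo w (cs k).p hw hp0
      exact ⟨lineRem f j v R (cs k).p, norm_lineRem_le_of_seam hRB (hpre k) hcol (by rw [abs_of_pos hpim.1]; exact hpim.2) hp0,
        h1, h2, h3, hav hp0, havc hp0⟩
    · obtain ⟨T, hT⟩ := exists_tendsto_lineRem_state hE hFv hv0 hiso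
      obtain ⟨h1, h2, h3⟩ := twoPoint_state hR hv0 hiso hfar htwo hT hw
      rw [hpv]
      exact ⟨T, norm_le_of_tendsto_state hRB hR hcol hv0 hvh hiso hT, h1, h2, h3, hva, hvac⟩
  choose G hGn hSmix hSd hGid hpa hpac using hdata
  -- reference summability `Σ 1/‖w − aᵢ‖² < ∞` (★M's absolute clause at `(w, w)`), and the reflected-source domination constant
  have hsq : Summable (fun i ↦ 1 / (‖w - a i‖ * ‖w - a i‖)) := (htwo w w hw hw).1
  set K : ℝ := 1 + 12 * Hs / R with hKdef
  have hdom : ∀ {p q : ℂ}, |p.re - v.re| ≤ R / 3 → |q.re - v.re| ≤ R / 3 → (∀ i, p ≠ a i) → (∀ i, q ≠ a i) →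
      (∀ i, p ≠ conj (a i)) → (∀ i, q ≠ conj (a i)) →
      ∀ i, 1 / (‖p - conj (a i)‖ * ‖q - conj (a i)‖) ≤ K ^ 2 * (1 / (‖p - a i‖ * ‖q - a i‖)) :=
    fun hp hq hpa' hqa' hpc hqc i ↦ inv_norm_mul_conj_le hR (hfar' i) (hstripa i) hp hq (hpa' i) (hqa' i) (hpc i) (hqc i)
  -- (a) the pull at `w` and its reflected twin are summable
  have hSw0 : Summable (fun i ↦ (1 / (w - a i)).im) := (hpull w hw hwim hwre).1
  have hSw : Summable (fun i ↦ (1 / (w - conj (a i))).im) := by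
    refine Summable.of_norm_bounded ((hsq.mul_left (K ^ 2)).mul_left (|w.im| + Hs)) fun i ↦ ?_
    rw [Real.norm_eq_abs]
    have h1 := abs_im_one_div_sub_le (w := w) (a := conj (a i)) (Hs := Hs) hR (by rw [conj_re]; exact hfar' i)
      (by rw [conj_im, abs_neg]; exact hstripa i) hwre (havc hw i)
    rw [sub_self, norm_zero, mul_zero, zero_div, add_zero, one_pow, mul_one] at h1
    exact h1.trans (mul_le_mul_of_nonneg_left (hdom hwre hwre (hav hw) (hav hw) (havc hw) (havc hw) i)
      (add_nonneg (abs_nonneg _) hHs0))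
  -- (b) the two-point differences at `(w, p_k)` and their reflected twins are summable
  have hSc : ∀ k, Summable (fun i ↦ (1 / (w - conj (a i)) - 1 / ((cs k).p - conj (a i)))) := by
    intro k
    by_cases hwp : w = (cs k).p
    · rw [← hwp]
      simp only [sub_self]
      exact summable_zero
    refine Summable.of_norm_bounded (((hSmix k).mul_left (K ^ 2)).mul_left ‖(cs k).p - w‖) fun i ↦ ?_
    have e1 : w - conj (a i) ≠ 0 := sub_ne_zero.mpr (havc hw i)
    have e2 : (cs k).p - conj (a i) ≠ 0 := sub_ne_zero.mpr (hpac k i)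
    have : 1 / (w - conj (a i)) - 1 / ((cs k).p - conj (a i)) = ((cs k).p - w) / ((w - conj (a i)) * ((cs k).p - conj (a i))) := by
      field_simp
      ring
    rw [this, norm_div, norm_mul, div_eq_mul_one_div]
    exact mul_le_mul_of_nonneg_left (hdom hwre (hpslab k) (hav hw) (hpa k) (havc hw) (hpac k) i) (norm_nonneg _)
  -- the pair kernel splits into the list term and its reflected twin
  have hpk : ∀ k i, farPairK (a i) w - farPairK (a i) (cs k).p =
      (1 / (w - a i) - 1 / ((cs k).p - a i)) + (1 / (w - conj (a i)) - 1 / ((cs k).p - conj (a i))) := by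
    intro k i
    unfold farPairK
    ring
  -- real parts along a direction
  have hgk : ∀ k, Summable (fun i ↦ (conj (cs k).e * (1 / (w - a i) - 1 / ((cs k).p - a i))).re) := fun k ↦
    (Complex.hasSum_re ((hSd k).mul_left _).hasSum).summable
  have hgkc : ∀ k, Summable (fun i ↦ (conj (cs k).e * (1 / (w - conj (a i)) - 1 / ((cs k).p - conj (a i)))).re) := fun k ↦
    (Complex.hasSum_re ((hSc k).mul_left _).hasSum).summable
  -- re-pairing: the reflected twins sum to the same value
  have hrep : ∀ k, ∑' i, (conj (cs k).e * (1 / (w - conj (a i)) - 1 / ((cs k).p - conj (a i)))).re =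
      ∑' i, (conj (cs k).e * (1 / (w - a i) - 1 / ((cs k).p - a i))).re := fun k ↦
    tsum_conj_eq (g := fun c ↦ (conj (cs k).e * (1 / (w - c) - 1 / ((cs k).p - c))).re) hn hexp (hgk k) (hgkc k)
  have hrepI : ∑' i, (1 / (w - conj (a i))).im = ∑' i, (1 / (w - a i)).im :=
    tsum_conj_eq (g := fun c ↦ (1 / (w - c)).im) hn hexp hSw0 hSw
  -- the hypotheses of `AssemblySig`, one by one
  have hm : ∀ _ : ι, (0 : ℝ) ≤ 1 / 2 := fun _ ↦ by norm_num
  have hstrip : ∀ i, MaxStrip v.re R (a i) := fun i ↦ ⟨hfar' i, (hstripa i).trans (by linarith)⟩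
  have hsum : ∀ k, Summable fun i ↦ (1 / 2 : ℝ) * (conj (cs k).e * (farPairK (a i) w - farPairK (a i) (cs k).p)).re := by
    intro k
    refine (((hgk k).add (hgkc k)).mul_left (1 / 2)).congr fun i ↦ ?_
    rw [hpk k i, mul_add (conj (cs k).e), add_re]
  have hsumc : Summable fun i ↦ (1 / 2 : ℝ) * farPairC w (a i) := by
    refine ((hSw0.add hSw).mul_left (-(1 / 2))).congr fun i ↦ ?_
    simp only [farPairC, farPairK, add_im]
    ring
  have hEq : -(lineRem f j v R w).im = ∑' i, (1 / 2 : ℝ) * farPairC w (a i) := by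
    have e1 : ∀ i, (1 / 2 : ℝ) * farPairC w (a i) = -(1 / 2) * ((1 / (w - a i)).im + (1 / (w - conj (a i))).im) := by
      intro i
      simp only [farPairC, farPairK, add_im]
      ring
    rw [tsum_congr e1, tsum_mul_left, hSw0.tsum_add hSw, hrepI, (hpull w hw hwim hwre).2.1]
    ring
  have hseam : ∀ k, (conj (cs k).e * lineRem f j v R w).re -
      ∑' i, (1 / 2 : ℝ) * (conj (cs k).e * (farPairK (a i) w - farPairK (a i) (cs k).p)).re ≤ η / s := by
    intro k
    have e1 : ∀ i, (1 / 2 : ℝ) * (conj (cs k).e * (farPairK (a i) w - farPairK (a i) (cs k).p)).re =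
        (1 / 2 : ℝ) * ((conj (cs k).e * (1 / (w - a i) - 1 / ((cs k).p - a i))).re +
          (conj (cs k).e * (1 / (w - conj (a i)) - 1 / ((cs k).p - conj (a i)))).re) := by
      intro i
      rw [hpk k i, mul_add (conj (cs k).e), add_re]
    have e2 : ∑' i, (conj (cs k).e * (1 / (w - a i) - 1 / ((cs k).p - a i))).re =
        (conj (cs k).e * (lineRem f j v R w - G k)).re := by
      rw [hGid k, ← tsum_mul_left, Complex.re_tsum ((hSd k).mul_left _)]
    rw [tsum_congr e1, tsum_mul_left, (hgk k).tsum_add (hgkc k), hrep k, e2]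
    have hre : (conj (cs k).e * G k).re ≤ η / s := by
      refine (Complex.re_le_norm _).trans ?_
      rw [norm_mul, Complex.norm_conj, (hadm.1 k).2.1, one_mul]
      exact hGn k
    have e3 : (conj (cs k).e * lineRem f j v R w).re -
        1 / 2 * ((conj (cs k).e * (lineRem f j v R w - G k)).re + (conj (cs k).e * (lineRem f j v R w - G k)).re) =
        (conj (cs k).e * G k).re := by
      rw [mul_sub, sub_re]
      ring
    rw [e3]
    exact hre
  exact sinkAssembly κ ι a (fun _ ↦ 1 / 2) v.re R cs w (lineRem f j v R w) (η / s) σ hm hstrip hadm hK hsum hsumc hEq hseam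

/-- ★ℓ (K) **CERTIFICATE ⇒ SINK INEQUALITY** (cut points at the state allowed): with C3's datum alternative (D) for an exponent `lam > 0` and any
modulus `gnorm` on top of (K), the frame's cap `2η ≤ 1` turns `L_cert ≤ η/s` into `gnorm ≤ lam·η/s` (as #1268's `le_of_certificate_mult`). -/
theorem le_of_certificate_lid {η : ℝ} {f : ℂ → ℂ} {x₀ s hmax R Hs : ℝ} {B : ℕ} (hE : EngineHyps5 2 η f x₀ s hmax R Hs B)
    {j : ℕ} {v w : ℂ} (hRB : LevelRemainderBox η f x₀ s hmax R j) (hcol : |v.re - x₀| ≤ R / 2) (hFv : iteratedDeriv j f v = 0)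
    (hv0 : 0 < v.im)
    (hiso : ∀ z : ℂ, iteratedDeriv j f z = 0 → |z.re - v.re| < R / 2 → z = v ∨ z = conj v)
    (hw : iteratedDeriv j f w ≠ 0) (hwim : 0 < w.im) (hwre : |w.re - v.re| ≤ R / 3)
    {κ : Type} [Fintype κ] {cs : κ → Cut} (hadm : CutsAdmissible v.re cs)
    (hpts : ∀ k, (iteratedDeriv j f (cs k).p ≠ 0 ∧ 0 < (cs k).p.im ∧ (cs k).p.im ≤ hmax) ∨ ((cs k).p = v ∧ v.im ≤ hmax))
    {σ lam gnorm : ℝ} (hlam : 0 < lam) (hK : KernelDom v.re R cs w σ)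
    (hD : DatumAlt lam s gnorm cs (lineRem f j v R w) σ) : gnorm ≤ lam * η / s := by
  have hL := lcert_le_of_kernelDom_lid hE hRB hcol hFv hv0 hiso hw hwim hwre hadm hpts hK
  have hs0 : 0 < s := hE.2.2.2.1
  have hη2 : 2 * η ≤ 1 := hE.2.2.2.2.2.2.2.2.2.2.2.2.2.2.1
  rcases hD with h | h
  · have h' := h.trans hL
    rw [div_le_iff₀ hlam] at h'
    calc gnorm ≤ η / s * lam := h'
      _ = lam * η / s := by ring
  · exfalso
    have h1 : 1 / (2 * s) < η / s := h.trans_le hL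
    rw [div_lt_div_iff₀ (by positivity) hs0] at h1
    nlinarith

/-! ## §L2 102's certificate closes the sink UP TO AND INCLUDING THE LID -/

/-- ★ℓ (K) **102's `CertificatesExistSig lam` CLOSES THE SINK at a state of ANY multiplicity with `Im v ≤ hmax` — LID INCLUDED**: #1268's ★3m
`RhW08.SinkFeedM.norm_farFieldAt_le_of_certificatesExist_mult` with its binder `Im v < hmax` relaxed to `Im v ≤ hmax`.  At the lid the certificate's
top cut point `⟨Re v, hmax⟩` IS the state `v`; its seam read is the state read `T` of «FarStateRead» (never the junk value `lineRem f j v R v`).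
So for a legal frame with the level-`j` seam, an `R/2`-isolated state `v` (`0 < Im v ≤ hmax`) in the column `|Re v − x₀| ≤ R/2` and a child `w`
in the nested disc of drop `< s/4`: `‖farFieldAt f j v w‖ ≤ lam·η/s`.  Below the lid this is ★3m (the cited special case, #1268 :206). -/
theorem norm_farFieldAt_le_of_certificatesExist_lid {lam : ℝ} (hcert : CertificatesExistSig lam) (hlam : 0 < lam) {η : ℝ} {f : ℂ → ℂ}
    {x₀ s hmax R Hs : ℝ} {B : ℕ} (hE : EngineHyps5 2 η f x₀ s hmax R Hs B) {j : ℕ} {v w : ℂ} (hRB : LevelRemainderBox η f x₀ s hmax R j)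
    (hcol : |v.re - x₀| ≤ R / 2) (hFv : iteratedDeriv j f v = 0) (hv0 : 0 < v.im) (hvh : v.im ≤ hmax)
    (hiso : ∀ z : ℂ, iteratedDeriv j f z = 0 → |z.re - v.re| < R / 2 → z = v ∨ z = conj v)
    (hw : iteratedDeriv j f w ≠ 0) (hw' : iteratedDeriv (j + 1) f w = 0) (hwim : 0 < w.im) (hdrop : v.im - s / 4 < w.im)
    (hdisc : ‖w - (v.re : ℂ)‖ ≤ |v.im|) : ‖farFieldAt f j v w‖ ≤ lam * η / s := by
  have hs0 : 0 < s := hE.2.2.2.1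
  have h2s : 2 * s ≤ hmax := hE.2.2.2.2.1
  have h3R : 3 * hmax < R := hE.2.2.2.2.2.2.1
  have hR : 0 < R := RhW08.ClusterQ.R_pos_of_engine hE
  -- the nested disc in coordinates
  have hdisc' : ‖w - (v.re : ℂ)‖ ≤ v.im := by rwa [abs_of_pos hv0] at hdisc
  have hn2 : ‖w - (v.re : ℂ)‖ ^ 2 = (w.re - v.re) ^ 2 + w.im ^ 2 := by
    rw [Complex.sq_norm, Complex.normSq_apply]
    simp
    ring
  have hsq : (w.re - v.re) ^ 2 + w.im ^ 2 ≤ v.im ^ 2 := by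
    rw [← hn2]
    exact pow_le_pow_left₀ (norm_nonneg _) hdisc' 2
  have hwle : w.im ≤ v.im := by
    have h := abs_le_of_sq_le_sq (a := w.im) (b := v.im) (by nlinarith [sq_nonneg (w.re - v.re)]) hv0.le
    rwa [abs_of_pos hwim] at h
  have hwlt : w.im < v.im := by
    rcases lt_or_eq_of_le hwle with h | h
    · exact h
    · exfalso
      have hre : (w.re - v.re) ^ 2 ≤ 0 := by nlinarith
      have hre0 : w.re - v.re = 0 := pow_eq_zero_iff two_ne_zero |>.mp (le_antisymm hre (sq_nonneg _))
      exact hw (by rw [Complex.ext (by linarith) h]; exact hFv)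
  have hwre : |w.re - v.re| ≤ R / 3 := by
    have h1 : |w.re - v.re| ≤ v.im := abs_le_of_sq_le_sq (by nlinarith [sq_nonneg w.im]) hv0.le
    linarith
  -- C3's certificate at the state's multiplicity `m = ord_v f⁽ʲ⁾ ≥ 1` (102 allows `Im v ≤ h`)
  have hm1 : 1 ≤ (analyticOrderAt (iteratedDeriv j f) v).toNat := one_le_order_toNat hE hFv hw
  obtain ⟨n, cs, σ, hadm, hpts, hK, hD⟩ :=
    hcert v.re R s hmax v w _ hs0 h2s h3R rfl hv0 hvh hwim hwlt hdrop hsq hm1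
  -- the cut points: the child-height point is a non-zero of the box off `v`; the top point is a non-zero below the lid, or `v` itself AT the lid
  have hoff : ∀ p : ℂ, p.re = v.re → 0 < p.im → p.im ≠ v.im → iteratedDeriv j f p ≠ 0 := by
    intro p hpre hpim hpv hz
    rcases hiso p hz (by rw [hpre, sub_self, abs_zero]; linarith) with h | h
    · exact hpv (by rw [h])
    · have : p.im = -v.im := by rw [h, conj_im]
      linarith
  have hpts' : ∀ k, (iteratedDeriv j f (cs k).p ≠ 0 ∧ 0 < (cs k).p.im ∧ (cs k).p.im ≤ hmax) ∨ ((cs k).p = v ∧ v.im ≤ hmax) := by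
    intro k
    rcases hpts k with h | h
    · have hre : (cs k).p.re = v.re := by rw [h]
      have him : (cs k).p.im = w.im := by rw [h]
      exact Or.inl ⟨hoff _ hre (by rw [him]; exact hwim) (by rw [him]; exact hwlt.ne), by rw [him]; exact hwim, by rw [him]; linarith⟩
    · by_cases hlid : hmax = v.im
      · exact Or.inr ⟨by rw [h, hlid], hvh⟩
      · have hre : (cs k).p.re = v.re := by rw [h]
        have him : (cs k).p.im = hmax := by rw [h]
        exact Or.inl ⟨hoff _ hre (by rw [him]; linarith) (by rw [him]; exact hlid), by rw [him]; linarith, by rw [him]⟩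
  -- the read value of the certificate is the line remainder `−m·K_v(w)` (closed form at a child), the bounded modulus is the far field
  have hFcv : iteratedDeriv j f (conj v) = 0 := by rw [iteratedDeriv_conj hE, hFv, map_zero]
  have hL1 : lineRem f j v R w = -(((analyticOrderAt (iteratedDeriv j f) v).toNat : ℂ) * farPairK v w) := by
    rw [lineRem_eq hiso hFv hFcv hR hv0 w, levelField_child hw', analyticOrderAt_conj_eq hE, farPairK]
    simp only [one_div]
    ring
  have hN : ‖farPairK v w‖ = ‖farFieldAt f j v w‖ := by
    rw [farFieldAt_child v hw', norm_neg, farPairK]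
    simp only [one_div]
  rw [← hL1, hN] at hD
  exact le_of_certificate_lid hE hRB hcol hFv hv0 hiso hw hwim hwre hadm hpts' hlam hK hD

end RhW08.SinkFeedLid

end
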